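import Mathlib.Analysis.InnerProductSpace.Projection.FiniteDimensional
import Mathlib.Geometry.Manifold.MFDeriv.SpecificFunctions
import Literature.Barriers.SmoothPoincare4.GluckTwistsDissolveRasmussenProofs
import Literature.Topology.FourManifolds.SmoothOrientation
import Literature.Topology.FourManifolds.OrientedConnectedSumTransportProofs
import Literature.Topology.FourManifolds.OrientedConnectedSumUniqueness
import HarnessLib

/-!
# Mirror of an oriented ball chart (stub `stub_sliceDiscIn_mirror_chart` of `embed-dont-dissolve`)

Support lemma for crux stmt-SmoothPoincare4-0368 (`ZeroSurgeryExotic.ZseSVanishesOnPairs` =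
`Literature.Uncategorized.SVanishesOnPairs`), line `embed-dont-dissolve`, stub 4
(`stub_sliceDiscIn_mirror_chart`), proved with its registered statement verbatim.

If `(e, f)` are slice data for a knot `K` in a smooth 4-manifold `P` (`Knot.IsSliceDiscIn P e f`:
a smooth ball `e : ℝ⁴ ↪ P` and a proper smooth disc `f|_{𝔻²}` in `P ∖ e(B̊⁴)` bounded by `e ∘ K`)
and the ball chart `e` is orientation preserving from the standard `ℝ⁴` to `(P, oP)`, then for the
coordinate reflection `ρ = reflectLastCLM 3` of `ℝ⁴` (the linear involution `x₃ ↦ -x₃`, which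
restricts on `S³` to the reflection `reflectLast 3` defining `Knot.mirror`):

* `(e ∘ ρ, f)` are slice data for the mirror `K̄ = K.mirror` (tree theorem
  `Knot.IsSliceDiscIn.mirror`, `GluckTwistsDissolveRasmussenProofs.lean`);
* the reflected chart `e ∘ ρ` is orientation preserving into the REVERSED orientation `(P, -oP)`:
  `ρ` is Mathlib's hyperplane reflection in `(ℝ e₃)ᗮ`, so `det ρ = -1` (`Submodule.det_reflection`)
  and `ρ` is its own differential; hence `ρ` carries `-(standard orientation)` to the standard
  orientation (both sides of the defining `↔` of `IsOrientationPreserving` are false: an orientation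
  is never its own negative, `Module.Ray.ne_neg_self`), and the composition lemma
  `IsOrientationPreserving.comp_holds` (the Jacobian of `e` is invertible:
  `det_mfderiv_ne_zero_of_isSmoothEmbedding` with `isOpen_range_of_isSmoothEmbedding_disc`) gives
  that `e ∘ ρ` preserves `-(standard)` and `oP`, i.e. (negating both orientations,
  `isOrientationPreserving_neg_neg_iff`) the standard orientation and `-oP`;
* `e ∘ ρ` has the same range as `e` (`ρ` is a bijection).

This is the tree form of Manolescu–Marengon–Sarkar–Willis 2023, §6.1, Remark 6.6 (*"`L` is
strongly H-slice in `ℂℙ²bar` iff `L̄` is strongly slice in `ℂℙ²`"*: orientation reversal of the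
ambient manifold exchanges a knot and its mirror), at the level of one slice datum with an oriented
ball chart. Everything here is proved; no definitions, no named facts, no instances.

## References

* C. Manolescu, M. Marengon, S. Sarkar, M. Willis, *A generalization of Rasmussen's invariant, with
  applications to surfaces in some four-manifolds*, Duke Math. J. 172 (2023), §6.1, Remark 6.6.
  [cite: ManolescuMarengonSarkarWillis2023, §6.1, Remark 6.6]
* M. W. Hirsch, *Differential Topology*, GTM 33 (1976), Ch. 4 §4 (reflections reverse orientation;
  orientation-preserving maps compose). [cite: HirschDT1976, Ch. 4 §4]
-/

noncomputable section

open scoped Manifold ContDiff Topology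
open Set Function
open Literature.Topology.FourManifolds

-- The gate's directory-mirrored namespace `Summit.SmoothPoincare4.SmoothPoincare4.…` stutters.
set_option linter.dupNamespace false

namespace Summit.SmoothPoincare4.SmoothPoincare4.Theorems.ZseSVanishesOnPairs

/-- Local notation: the model space `ℝⁿ`. -/
local notation "𝔼 " n:arg => EuclideanSpace ℝ (Fin n)

/-! ### The coordinate reflection `reflectLastCLM n` of `ℝⁿ⁺¹`: determinant and differential -/

/-- The coordinate reflection `reflectLastCLM n : (x₀, …, xₙ) ↦ (x₀, …, xₙ₋₁, -xₙ)` of `ℝⁿ⁺¹` is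
Mathlib's reflection in the hyperplane `(ℝ eₙ)ᗮ` orthogonal to the last basis vector. [folklore] -/
theorem reflectLastCLM_apply_eq_reflection (n : ℕ) (v : 𝔼 (n + 1)) :
    reflectLastCLM n v = (ℝ ∙ EuclideanSpace.single (Fin.last n) (1 : ℝ))ᗮ.reflection v := by
  ext i
  rw [Submodule.reflection_orthogonal_apply, Submodule.reflection_singleton_apply,
    EuclideanSpace.inner_single_left]
  simp only [reflectLastCLM, ContinuousLinearMap.coe_mk', LinearMap.coe_mk, AddHom.coe_mk,
    PiLp.toLp_apply, map_one, one_mul, EuclideanSpace.single, PiLp.norm_single, norm_one, one_pow,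
    div_one, PiLp.neg_apply, PiLp.sub_apply, PiLp.smul_apply, PiLp.single_apply, smul_eq_mul,
    nsmul_eq_mul, Nat.cast_ofNat]
  split_ifs with h
  · subst h
    ring
  · ring

/-- **The determinant of the coordinate reflection `reflectLastCLM n` of `ℝⁿ⁺¹` is `-1`**
(`Submodule.det_reflection`: the reflection in `K = (ℝ eₙ)ᗮ` has determinant
`(-1) ^ finrank Kᗮ = (-1) ^ 1`). [folklore] -/
theorem det_reflectLastCLM (n : ℕ) :
    LinearMap.det ((reflectLastCLM n : 𝔼 (n + 1) →L[ℝ] 𝔼 (n + 1)) : 𝔼 (n + 1) →ₗ[ℝ] 𝔼 (n + 1)) =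
      -1 := by
  have hne : EuclideanSpace.single (Fin.last n) (1 : ℝ) ≠ 0 := by
    intro h
    have := congrArg (fun x : 𝔼 (n + 1) => x (Fin.last n)) h
    simp at this
  have h1 := (ℝ ∙ EuclideanSpace.single (Fin.last n) (1 : ℝ))ᗮ.det_reflection
  rw [Submodule.orthogonal_orthogonal, finrank_span_singleton hne, pow_one] at h1
  have heq : ((reflectLastCLM n : 𝔼 (n + 1) →L[ℝ] 𝔼 (n + 1)) : 𝔼 (n + 1) →ₗ[ℝ] 𝔼 (n + 1)) =
      (ℝ ∙ EuclideanSpace.single (Fin.last n) (1 : ℝ))ᗮ.reflection.toLinearMap := by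
    apply LinearMap.ext
    intro v
    exact reflectLastCLM_apply_eq_reflection n v
  rw [heq]
  exact h1

/-- The differential of the linear map `reflectLastCLM n` at every point is `reflectLastCLM n`
itself. [folklore] -/
theorem mfderiv_reflectLastCLM (n : ℕ) (x : 𝔼 (n + 1)) :
    mfderiv 𝓘(ℝ, 𝔼 (n + 1)) 𝓘(ℝ, 𝔼 (n + 1)) (reflectLastCLM n) x =
      (reflectLastCLM n : 𝔼 (n + 1) →L[ℝ] 𝔼 (n + 1)) :=
  ContinuousLinearMap.mfderiv_eq _

/-- The Jacobian determinant of `reflectLastCLM n` is `-1` at every point. [folklore] -/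
theorem det_mfderiv_reflectLastCLM (n : ℕ) (x : 𝔼 (n + 1)) :
    LinearMap.det (M := 𝔼 (n + 1))
      (mfderiv 𝓘(ℝ, 𝔼 (n + 1)) 𝓘(ℝ, 𝔼 (n + 1)) (reflectLastCLM n) x).toLinearMap = -1 := by
  have h := det_reflectLastCLM n
  rw [← mfderiv_reflectLastCLM n x] at h
  exact h

/-- **The coordinate reflection reverses the standard orientation of `ℝⁿ⁺¹`**: it is orientation
preserving from `-(standard orientation)` to the standard orientation, since at every point both
sides of the defining equivalence fail — the standard orientation is not its own negative
(`Module.Ray.ne_neg_self`) and the Jacobian determinant is `-1 < 0` (Hirsch, *Differential Topology*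
(1976), Ch. 4 §4: a reflection in a hyperplane reverses orientation).
[cite: HirschDT1976, Ch. 4 §4] -/
theorem isOrientationPreserving_reflectLastCLM (n : ℕ) :
    IsOrientationPreserving (-SmoothOrientation.euclidean (n + 1))
      (SmoothOrientation.euclidean (n + 1)) (reflectLastCLM n) := by
  intro x
  have h1 : SmoothOrientation.euclidean (n + 1) (reflectLastCLM n x) ≠
      (-SmoothOrientation.euclidean (n + 1)) x := by
    rw [SmoothOrientation.neg_apply, SmoothOrientation.euclidean_apply,
      SmoothOrientation.euclidean_apply]
    exact Module.Ray.ne_neg_self _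
  have h2 : ¬ 0 < LinearMap.det (M := 𝔼 (n + 1))
      (mfderiv 𝓘(ℝ, 𝔼 (n + 1)) 𝓘(ℝ, 𝔼 (n + 1)) (reflectLastCLM n) x).toLinearMap := by
    rw [det_mfderiv_reflectLastCLM]
    norm_num
  exact iff_of_false h1 h2

/-- The Jacobian determinant of `reflectLastCLM n` vanishes nowhere. [folklore] -/
theorem det_mfderiv_reflectLastCLM_ne_zero (n : ℕ) (x : 𝔼 (n + 1)) :
    LinearMap.det (M := 𝔼 (n + 1))
      (mfderiv 𝓘(ℝ, 𝔼 (n + 1)) 𝓘(ℝ, 𝔼 (n + 1)) (reflectLastCLM n) x).toLinearMap ≠ 0 := by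
  rw [det_mfderiv_reflectLastCLM]
  norm_num

/-- Precomposing with the involution `reflectLastCLM n` does not change the range of a map.
[folklore] -/
theorem range_comp_reflectLastCLM {X : Type*} (n : ℕ) (e : 𝔼 (n + 1) → X) :
    range (e ∘ reflectLastCLM n) = range e :=
  (Function.Involutive.surjective (reflectLastCLM_reflectLastCLM n)).range_comp e

/-! ### Reflecting an orientation-preserving ball chart -/

/-- **A reflected orientation-preserving open embedding of `ℝⁿ⁺¹` is orientation preserving into the
reversed orientation.** If `e : ℝⁿ⁺¹ → P` is a smooth embedding into an `(n+1)`-manifold which is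
orientation preserving from the standard orientation to `oP`, then `e ∘ reflectLastCLM n` is
orientation preserving from the standard orientation to `-oP`: compose the orientation reversal
`reflectLastCLM n` (`isOrientationPreserving_reflectLastCLM`) with `e`
(`IsOrientationPreserving.comp_holds`; the Jacobian of `e` is invertible because its range is open
by invariance of domain, `det_mfderiv_ne_zero_of_isSmoothEmbedding`,
`isOpen_range_of_isSmoothEmbedding_disc`) and negate both orientations
(`isOrientationPreserving_neg_neg_iff`). [cite: HirschDT1976, Ch. 4 §4] -/
theorem isOrientationPreserving_neg_comp_reflectLastCLM {n : ℕ} {P : Type*} [TopologicalSpace P]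
    [ChartedSpace (𝔼 (n + 1)) P] [IsManifold (𝓡 (n + 1)) ∞ P] {oP : SmoothOrientation (𝓡 (n + 1)) P}
    {e : 𝔼 (n + 1) → P} (he : Manifold.IsSmoothEmbedding (𝓡 (n + 1)) (𝓡 (n + 1)) ∞ e)
    (ho : IsOrientationPreserving (SmoothOrientation.euclidean (n + 1)) oP e) :
    IsOrientationPreserving (SmoothOrientation.euclidean (n + 1)) (-oP) (e ∘ reflectLastCLM n) := by
  have hed : MDifferentiable (𝓡 (n + 1)) (𝓡 (n + 1)) e := he.contMDiff.mdifferentiable (by simp)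
  have hρd : MDifferentiable 𝓘(ℝ, 𝔼 (n + 1)) 𝓘(ℝ, 𝔼 (n + 1)) (reflectLastCLM n) :=
    (reflectLastCLM n).mdifferentiable
  have he' : ∀ y, LinearMap.det (M := 𝔼 (n + 1))
      (mfderiv (𝓡 (n + 1)) (𝓡 (n + 1)) e y).toLinearMap ≠ 0 :=
    det_mfderiv_ne_zero_of_isSmoothEmbedding he (isOpen_range_of_isSmoothEmbedding_disc he)
  have h : IsOrientationPreserving (-SmoothOrientation.euclidean (n + 1)) oP
      (e ∘ reflectLastCLM n) :=
    IsOrientationPreserving.comp_holds ho (isOrientationPreserving_reflectLastCLM n) hed hρd he'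
      (det_mfderiv_reflectLastCLM_ne_zero n)
  rw [← isOrientationPreserving_neg_neg_iff, neg_neg]
  exact h

/-! ### The stub -/

/-- **STUB 4 of line `embed-dont-dissolve` — mirror of an oriented ball chart.** If `(e, f)` are
slice data for `K` in `P` (`Knot.IsSliceDiscIn P e f`) and the ball chart `e` is orientation
preserving from the standard `ℝ⁴` to `(P, oP)`, then for the coordinate reflection
`ρ = reflectLastCLM 3` of `ℝ⁴`: `(e ∘ ρ, f)` are slice data for the mirror `K.mirror`
(`Knot.IsSliceDiscIn.mirror`), the reflected chart `e ∘ ρ` is orientation preserving into the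
reversed orientation `(P, -oP)` (`det ρ = -1`, so `ρ` reverses the standard orientation of `ℝ⁴`;
compose with `e`), and `e ∘ ρ` has the same range as `e` (`ρ` is a bijection). This is the tree
form of MMSW's remark that `L` is strongly H-slice in `ℂℙ²bar` iff `L̄` is strongly slice in `ℂℙ²`
(orientation reversal of the ambient manifold exchanges a knot and its mirror).
[cite: ManolescuMarengonSarkarWillis2023, §6.1, Remark 6.6] -/
theorem stub_sliceDiscIn_mirror_chart :
    ∀ (K : Knot) (P : Type) [TopologicalSpace P] [T2Space P] [SecondCountableTopology P] [ChartedSpace (𝔼 4) P]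
      [IsManifold (𝓡 4) ∞ P] (oP : SmoothOrientation (𝓡 4) P) (e : 𝔼 4 → P) (f : 𝔼 2 → P),
      K.IsSliceDiscIn P e f → IsOrientationPreserving (SmoothOrientation.euclidean 4) oP e →
      K.mirror.IsSliceDiscIn P (e ∘ reflectLastCLM 3) f ∧
        IsOrientationPreserving (SmoothOrientation.euclidean 4) (-oP) (e ∘ reflectLastCLM 3) ∧
        range (e ∘ reflectLastCLM 3) = range e := by
  intro K P _ _ _ _ _ oP e f hef he
  exact ⟨hef.mirror, isOrientationPreserving_neg_comp_reflectLastCLM hef.isSmoothEmbedding he,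
    range_comp_reflectLastCLM 3 e⟩

end Summit.SmoothPoincare4.SmoothPoincare4.Theorems.ZseSVanishesOnPairs

end
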